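import Summits.BirchSwinnertonDyer.BirchSwinnertonDyer.Theorems.GenusKolyvaginAtTwoPowDvdShaCardAtTwoPosTE4PosOfSockets
import Summits.BirchSwinnertonDyer.BirchSwinnertonDyer.Theorems.GenusKolyvaginAtTwoPowDvdShaCardAtTwoPosTTranspositionPairChebotarev
import Summits.BirchSwinnertonDyer.BirchSwinnertonDyer.Theorems.GenusKolyvaginAtTwoPowDvdShaCardAtTwoPosTEigenIndexTwoRegularSocket
import Summits.BirchSwinnertonDyer.BirchSwinnertonDyer.Theorems.GenusKolyvaginAtTwoPowDvdShaCardAtTwoPosTRankLeOnePosCut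
import Summits.BirchSwinnertonDyer.BirchSwinnertonDyer.Theorems.GenusKolyvaginAtTwoPowDvdShaCardAtTwoPosTDeepSwapSocketTransposition
import Summits.BirchSwinnertonDyer.BirchSwinnertonDyer.Theorems.GenusKolyvaginAtTwoPowDvdShaCardAtTwoPosTBottomRungTransverseSocketTransposition
import HarnessLib

/-!
# Route `GenusKolyvaginAtTwo` — THE CRUX L⁺_T′ `PowDvdShaCardAtTwoPosT` (stmt-BirchSwinnertonDyer-25501, rev 48 = R9-L / R9-FINAL) BY NAME:
# `2^(2M₀) ∣ #Ш(E/K)[2^∞]` on the Δ>0 cut from a TRANSPOSITION-DEEP Kolyvagin witness — road (E4)⁺ (LINE «plus_descent_e4pos»)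

Seat `bsd-line-gk2-p2` g22 (PROVER seat 2/3, cell `bsd-f1-sign2`; (E4)⁺ assembly owner per LEAD rulings R10′/R10″), `--workitem stmt-BirchSwinnertonDyer-25501`.
THEOREMS ONLY (no definition, no named fact, no `sorry`).  **BSD is NOT proved by this file**; neither is the parent Q4_T″ (stmt-25502: one line away via the
LEAD's `kolyvaginExactAtTwoPosDiscT_of_powDvdShaCardAtTwoPosT`, p759566), nor the route's deciding theorem (supply⁺ 25504, Δ<0 supply 23491, Q2 24880 open).
What IS proved: the route item L⁺_T′ — the LOWER / exhibition half of Kolyvagin's structure theorem at `p = 2` on the Δ>0 cut of the habitat, modulo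
its own antecedent Q2 `KolyvaginRelationAtTwo`.

THE COMPOSITION (= the registered skeleton `Cruxes/…/Lines/plus_descent_e4pos.lean` with its one stub discharged; road (E4)⁺ = LINE 18's road (E4), which
closed the Δ<0 lower half L_T (p744020), re-run at TRANSPOSITION-type Kolyvagin primes — «Frob_ℓ moves a point of `E[2]`», the Δ>0 substitute for Gross's
`Frob(ℓ) = Frob(∞)`, which fixes `E[2]` when `Δ > 0`):
* assembly `GenusExact.PlusDescent.pow_dvd_natCard_sha_of_sockets_of_rank_le_one_transposition` (this seat, p758597) = sign-free capstone
  `pow_dvd_natCard_sha_of_kolyvaginSupplies_of_orthogonal_of_rank_le_one` (gk2-p2 g20 / gk2-p4 g21, p741898) ∘ X-ORTH∃⁺ `ctOrthogonalAtTwo_of_frame_transposition`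
  (this seat, p756885, over gk2-p4 g20 / gk2-p5 g27's Cassels–Tate chain) ∘ KS⁺ integrator `kolyvaginSuppliesAtTwo_of_deepSwap_transposition` (this seat, p758303;
  minima `exists_kolyvaginMinima_transposition` p758223, regular supply p756826) — level `L = 2(M₀+6)`, margin `1`, class `L+1 ≤ idx ∧ TRANSP`;
* sockets: hCheb := gk2-p5 g32 `exists_transposition_kolyvaginPrime_localization_fullOrder_pair_deep` (p756802, over gk2-p4 g23's regular signed
  pair-Čebotarev p754753); hK⁺ := gk2-p4 g24 `hK_socket_margin_of_frob_smul_ne` (p756743); hswap⁺ := gk2-p5 g32 `deepSwap_socket_transposition` (p758726) with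
  (NPh) from the odd multiplicative place (gk2-p3 `NonPhantomPow.nonPhantomAtTwo_of_hasMultiplicativeReductionAt`); hbot⁺ := gk2-p4 g24
  `TransverseValue.hbot_socket_margin_onHabitat_of_three_le_transposition` (with gk2-p5 g32's hTr⁺ p759413) fed with the item's transposition-deep witness;
* `rank E(K) ≤ 1` on the cut := this seat's `mordellWeilRank_baseChange_le_one_onPosCut` (p758733: B2Q⁺ `stub_b2qSignFree` gk2-p5 g31 p755582 ⟹ `rank E(ℚ)=0`
  (gk2-p3 g27 Kummer lemma) ⟹ `+ rank E^{d_K}(ℚ) ≤ 1` from `#Sel₂(Wd) = 2`).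
TRANSP (level-free): `∃ v 𝔓 (h : Γ_ℚ), (ℓ : 𝓞 ℚ) ∈ v.asIdeal ∧ 𝔓 ∈ v.primesAbove ∧ IsArithFrobAt (𝓞 ℚ) h 𝔓 ∧ ∃ u : geomTorsion W 2, h • u ≠ u`; the item's
`W.geomTorsion ((2 : ℕ) : ℤ)` spelling converts by gk2-p5's `exists_smul_ne_two_of_natCast`.

References: [McCallumLMS1991] §4 Prop. 4.7, §5 Prop. 5.2, Thm. 5.4; [Kolyvagin1991StructureSha]; [Kolyvagin1991MathAnn] Thm. 2.1–2.2; [GrossLMS1991] §3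
(3.1)–(3.3), §5 Props. 5.3–5.4, §10; [Kramer1981] Thm. 1; [Kolyvagin1989Izv] Thm. B₂; [WZhang2014] Notations (xii).
-/



set_option autoImplicit false
set_option linter.dupNamespace false

noncomputable section

open scoped Classical
open scoped AddSubgroup
open Function Field NumberField IsDedekindDomain WeierstrassCurve
open Literature.NumberTheory.EllipticCurves Literature.NumberTheory.GaloisRepresentations
open Literature.NumberTheory.EllipticCurves.ModularForms
open Literature.NumberTheory.GaloisCohomology
open Summit.BirchSwinnertonDyer.Rank1Residual.JET.GlobalDuality
open Summit.BirchSwinnertonDyer.BirchSwinnertonDyer.Theses.GenusKolyvaginAtTwo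
open Summit.BirchSwinnertonDyer.Rank1Residual
open Summit.BirchSwinnertonDyer.BirchSwinnertonDyer.Theorems.GenusExact.PlusDescent

namespace Summit.BirchSwinnertonDyer.BirchSwinnertonDyer.Theorems

/-- **L⁺_T′ `PowDvdShaCardAtTwoPosT` (stmt-BirchSwinnertonDyer-25501) PROVED: on the Δ>0 cut of the route's habitat, from Q2, `2^(2M₀) ∣ #Ш(E/K)[2^∞]`** —
the lower half of Kolyvagin's structure theorem at `p = 2` with TRANSPOSITION-type Kolyvagin primes.  Road (E4)⁺ by name (see the module docstring for the
cone and the owners of each socket).  BSD is NOT proved by this; neither is Q4_T″ (one line away) nor the route's deciding theorem.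
[cite: McCallumLMS1991, §5 Prop. 5.2, Thm. 5.4 (p. 310)] [cite: Kolyvagin1991StructureSha] [cite: Kolyvagin1991MathAnn, Thm. 2.1–2.2] [cite: GrossLMS1991, §1 Thm. 1.3, §10]
[cite: Kramer1981, Thm. 1] -/
theorem powDvdShaCardAtTwoPosT_proof : PowDvdShaCardAtTwoPosT := by
  intro hQ2 W _ _ _ hcm hT v h2v hNv hmult _hpos K _ _ hIQ hodd h3 hHe hsq1 hsq2 hρ Dt β ι d₁ hy M₀ hdiv hndiv hw Wd _ _ hWd hSel _hTam
    n₀ e₀ hn₀ hKoly he₀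
  obtain ⟨τ, hτ, -⟩ := exists_conj_of_isImaginaryQuadratic (K := K) hIQ
  haveI : ∀ j : ℕ, NumberField (ringClassField K ι j) := JET.numberField_ringClassField K hIQ ι
  have hsurN' : ∀ m : ℕ, W.HasSurjectiveModNGaloisRep (2 ^ m : ℕ) := fun m ↦ by
    exact_mod_cast Summit.BirchSwinnertonDyer.BirchSwinnertonDyer.Theorems.MinimalTwinBSDTwo.forall_hasSurjectiveModNGaloisRep_two_pow_of_pos W hρ m
  -- R⁺: `rank E(K) ≤ 1` on the cut (this seat, `…PosTRankLeOnePosCut`, p758733)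
  have hrk : (W.baseChange K).mordellWeilRank ≤ 1 :=
    mordellWeilRank_baseChange_le_one_onPosCut hQ2 W hcm hT v h2v hNv hmult K hIQ hodd h3 hHe hsq1 hsq2 hρ Dt β ι d₁ hy M₀ hndiv hw Wd hWd hSel
  -- the item's witness clause in the Theorems' spelling (`geomTorsion W 2`)
  have hKoly' : ∀ ℓ ∈ n₀.primeFactors, Zhang2014.IsKolyvaginPrime (W.conductorNorm ℤ) W K 2 ℓ ∧ 2 ≤ Zhang2014.kolyvaginIndex W 2 ℓ ∧
      ∃ (v : HeightOneSpectrum (𝓞 ℚ)) (𝔓 : Ideal (absIntegers (𝓞 ℚ) ℚ)) (h : absoluteGaloisGroup ℚ),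
        (ℓ : 𝓞 ℚ) ∈ v.asIdeal ∧ 𝔓 ∈ v.primesAbove ∧ IsArithFrobAt (𝓞 ℚ) h 𝔓 ∧ ∃ u : geomTorsion W 2, h • u ≠ u := by
    intro ℓ hℓ
    obtain ⟨hZ, hidx, v', 𝔓, h, hv', h𝔓, hfr, hu⟩ := hKoly ℓ hℓ
    exact ⟨hZ, hidx, v', 𝔓, h, hv', h𝔓, hfr, exists_smul_ne_two_of_natCast W hu⟩
  exact pow_dvd_natCard_sha_of_sockets_of_rank_le_one_transposition hQ2 W hcm hT v h2v hNv hmult K hIQ hodd h3 hHe hsq1 hsq2 hρ Dt β ι d₁ hy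
    M₀ hdiv hndiv hrk τ hτ
    (exists_transposition_kolyvaginPrime_localization_fullOrder_pair_deep W K hIQ hodd hHe hsurN' τ hτ (2 * (M₀ + 6)) 1 (by omega))
    (GenusExact.TransverseValue.hbot_socket_margin_onHabitat_of_three_le_transposition W hQ2 hcm hT hsurN' hIQ hodd h3 hHe hsq1 hsq2 h2v hNv hmult
      Dt β ι (L := 2 * (M₀ + 6)) (by omega) 1 (by omega) _ (fun q _ hidx hF ↦ ⟨hidx, hF⟩) hn₀ hKoly' e₀ he₀)
    (deepSwap_socket_transposition W hcm hT hsurN' hIQ hodd h3 hHe τ hτ Dt β ι hQ2 (M₀ := M₀) (L := 2 * (M₀ + 6)) (k := 1) (by omega) le_rfl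
      (Summit.BirchSwinnertonDyer.BirchSwinnertonDyer.Theorems.GenusExact.NonPhantomPow.nonPhantomAtTwo_of_hasMultiplicativeReductionAt W hT hρ hIQ hodd hsq1 hsq2 (NeZero.ne (W.conductorNorm ℤ)) hHe h2v hNv hmult
        (2 * (M₀ + 6) + 1) (by omega)))
    (fun r ℓ hℓ C hC ↦ hK_socket_margin_of_frob_smul_ne W hIQ hτ (L := 2 * (M₀ + 6)) (by omega) r 1 ℓ hℓ C hC)

end Summit.BirchSwinnertonDyer.BirchSwinnertonDyer.Theorems

end
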